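import Summits.ValiantsHypothesis.ValiantsHypothesis.Theses.PolyaContinued
import Literature.Combinatorics.SimpleGraph.PfaffianBipartite
import Literature.Combinatorics.SimpleGraph.PerfectMatchingPoly
import HarnessLib

/-!
# Route PolyaContinued — support item `SignedCoverLittle` (stmt-ValiantsHypothesis-7426):
# reduction to a combinatorial label-transfer statement

`Summit.ValiantsHypothesis.ValiantsHypothesis.Theses.PolyaContinued.SignedCoverLittle` says: if the
perfect-matching polynomial `PM_E` (`E ⊆ K_{n,n}` with a perfect matching) is a Valiant projection
of `PM_{E'}` for a PFAFFIAN `E' ⊆ K_{n,n}` of the same size `n`, then `E` is Pfaffian.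

This file strips the statement of all algebra (`signedCoverLittle_iff_labelTransfer`): it is
EQUIVALENT to the following purely combinatorial transfer principle.

> **Label transfer.** Let `H, E ⊆ Fin n × Fin n`, `H` Pfaffian, and let `φ : Fin n × Fin n →
> Fin n × Fin n` be ANY relabelling of the cells (repetitions and misplacements allowed). If the
> "label polynomial" `Σ_{σ perfect matching of H} Π_i X (φ (i, σ i))` equals `PM_E`, i.e. the
> perfect matchings of `H`, read through their labels, are exactly the perfect matchings of `E`,
> each once, then `E` is Pfaffian.

Proof of the reduction (`signedCoverLittle_of_labelTransfer`). A projection `a` sends each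
variable of `PM_{E'}` to a variable `X (φ e)` or to a constant. Since `PM_E` is homogeneous of
degree `n` (`perfectMatchingPoly_isHomogeneous`), `PM_E = PM_{E'}(a)` equals its own degree-`n`
component, and the degree-`n` component of `PM_{E'}(a) = Σ_{σ ⊆ E'} Π_i a (i, σ i)` keeps exactly
the perfect matchings `σ` of `E'` all of whose cells carry variables
(`homogeneousComponent_prod_eq`): the constants are killed by degree, with no appeal to signs or
cancellations. What is left is the label polynomial of the subgraph `H ⊆ E'` of variable cells,
which is Pfaffian with `E'` (`IsPfaffianBipartite.anti`). Conversely
(`labelTransfer_of_signedCoverLittle`) a label polynomial identity is a projection all of whose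
values are variables, so the transfer principle is the special case "no constants" of the item;
the two are equivalent. The Pfaffian hypotheses/conclusions inlined by the route are converted with
`isPfaffianBipartite_iff_exists_mvPolynomial` (`PfaffianBipartite.lean`).

Status of the transfer principle (this session's evidence, not formalised): true when `φ` is
injective (isomorphic perfect-matching set systems have the same relative signs); verified by
exhaustive search for all `n ≤ 6` (a counterexample restricts, by Little's theorem, to a target
`E` = even subdivision of `K_{3,3}` plus a perfect matching, and to `H` = the union of the six
preimage matchings); open in general.
-/

noncomputable section

namespace Summit.ValiantsHypothesis.PolyaContinued

open MvPolynomial Finset Literature.Combinatorics.SimpleGraph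

variable {n : ℕ}

/-- Expansion of a substitution instance of `PM_{E'}`: `PM_{E'}(a) = Σ_{σ ⊆ E'} Π_i a (i, σ i)`.
[folklore] -/
theorem aeval_perfectMatchingPoly_eq_sum (E' : Finset (Fin n × Fin n))
    (a : Fin n × Fin n → MvPolynomial (Fin n × Fin n) ℂ) :
    aeval a (perfectMatchingPoly E' ℂ) =
      ∑ σ : Equiv.Perm (Fin n), if (∀ i, (i, σ i) ∈ E') then ∏ i, a (i, σ i) else 0 := by
  rw [perfectMatchingPoly_eq_sum_ite, map_sum]
  refine Finset.sum_congr rfl fun σ _ => ?_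
  split_ifs
  · rw [map_prod]
    exact Finset.prod_congr rfl fun i _ => aeval_X a _
  · exact map_zero _

/-- **Degree kills the constants.** If every `a e` is a variable or a constant, the degree-`n`
homogeneous component of `Π_{i : Fin n} a (i, σ i)` is the same product with the constants
replaced by `0`: it is the product itself when all `n` factors are variables, and `0` as soon as
one factor is a constant (the product is then homogeneous of degree `< n`). [folklore] -/
theorem homogeneousComponent_prod_eq (a : Fin n × Fin n → MvPolynomial (Fin n × Fin n) ℂ)
    (ha : ∀ e, (∃ j, a e = X j) ∨ ∃ c, a e = C c) (σ : Equiv.Perm (Fin n))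
    [DecidablePred fun e : Fin n × Fin n => ∃ j, a e = X j] :
    homogeneousComponent n (∏ i, a (i, σ i)) =
      ∏ i, (if ∃ j, a (i, σ i) = X j then a (i, σ i) else 0) := by
  -- degrees of the factors
  let d : Fin n × Fin n → ℕ := fun e => if ∃ j, a e = X j then 1 else 0
  have hd : ∀ e, (a e).IsHomogeneous (d e) := by
    intro e
    by_cases h : ∃ j, a e = X j
    · obtain ⟨j, hj⟩ := h
      have : d e = 1 := if_pos ⟨j, hj⟩
      rw [this, hj]
      exact isHomogeneous_X ℂ j
    · have : d e = 0 := if_neg h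
      rw [this]
      rcases ha e with h' | ⟨c, hc⟩
      · exact absurd h' h
      · rw [hc]; exact isHomogeneous_C _ c
  have hprod : (∏ i, a (i, σ i)).IsHomogeneous (∑ i, d (i, σ i)) :=
    IsHomogeneous.prod univ (fun i => a (i, σ i)) (fun i => d (i, σ i)) fun i _ => hd _
  by_cases hall : ∀ i, ∃ j, a (i, σ i) = X j
  · -- all factors are variables: homogeneous of degree `n`, component is itself
    have hsum : ∑ i, d (i, σ i) = n := by
      have : ∀ i, d (i, σ i) = 1 := fun i => if_pos (hall i)
      simp [this]
    rw [hsum] at hprod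
    rw [homogeneousComponent_eq_self hprod]
    exact Finset.prod_congr rfl fun i _ => (if_pos (hall i)).symm
  · -- some factor is a constant: degree `< n`, component vanishes, and so does the right side
    obtain ⟨i₀, hi₀⟩ := not_forall.mp hall
    have hlt : ∑ i, d (i, σ i) < n := by
      have h1 : ∑ i, d (i, σ i) < ∑ _i : Fin n, (1 : ℕ) := by
        refine Finset.sum_lt_sum (fun i _ => ?_) ⟨i₀, Finset.mem_univ _, ?_⟩
        · show (if _ then 1 else 0) ≤ 1
          split_ifs <;> omega
        · show (if _ then 1 else 0) < 1
          rw [if_neg hi₀]; omega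
      simpa using h1
    have hmem : (∏ i, a (i, σ i)) ∈ homogeneousSubmodule (Fin n × Fin n) ℂ (∑ i, d (i, σ i)) :=
      (mem_homogeneousSubmodule _ _).2 hprod
    rw [homogeneousComponent_of_mem hmem, if_neg (Nat.ne_of_gt hlt).symm.symm]
    · symm
      exact Finset.prod_eq_zero (Finset.mem_univ i₀) (if_neg hi₀)

/-- **The degree-`n` part of a projection of `PM_{E'}` is a label polynomial.** With `H ⊆ E'` the
cells carrying variables and `φ e` the variable carried by `e`, the degree-`n` homogeneous
component of `PM_{E'}(a)` is `Σ_{σ ⊆ H} Π_i X (φ (i, σ i))`. [folklore] -/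
theorem homogeneousComponent_aeval_perfectMatchingPoly (E' : Finset (Fin n × Fin n))
    (a : Fin n × Fin n → MvPolynomial (Fin n × Fin n) ℂ)
    (ha : ∀ e, (∃ j, a e = X j) ∨ ∃ c, a e = C c) (φ : Fin n × Fin n → Fin n × Fin n)
    (hφ : ∀ e j, a e = X j → a e = X (φ e))
    [DecidablePred fun e : Fin n × Fin n => ∃ j, a e = X j] :
    homogeneousComponent n (aeval a (perfectMatchingPoly E' ℂ)) =
      ∑ σ : Equiv.Perm (Fin n),
        if (∀ i, (i, σ i) ∈ E'.filter fun e => ∃ j, a e = X j) then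
          ∏ i, (X (φ (i, σ i)) : MvPolynomial (Fin n × Fin n) ℂ) else 0 := by
  rw [aeval_perfectMatchingPoly_eq_sum, map_sum]
  refine Finset.sum_congr rfl fun σ _ => ?_
  by_cases hσ : ∀ i, (i, σ i) ∈ E'
  · rw [if_pos hσ, homogeneousComponent_prod_eq a ha σ]
    by_cases hV : ∀ i, ∃ j, a (i, σ i) = X j
    · rw [if_pos (fun i => Finset.mem_filter.2 ⟨hσ i, hV i⟩)]
      refine Finset.prod_congr rfl fun i _ => ?_
      rw [if_pos (hV i)]
      obtain ⟨j, hj⟩ := hV i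
      exact hφ _ j hj
    · obtain ⟨i₀, hi₀⟩ := not_forall.mp hV
      have hnot : ¬ ∀ i, (i, σ i) ∈ E'.filter fun e => ∃ j, a e = X j := by
        intro h
        have hi : (i₀, σ i₀) ∈ E'.filter fun e => ∃ j, a e = X j := h i₀
        rw [Finset.mem_filter] at hi
        exact hi₀ hi.2
      rw [if_neg hnot]
      exact Finset.prod_eq_zero (Finset.mem_univ i₀) (if_neg hi₀)
  · have hnot : ¬ ∀ i, (i, σ i) ∈ E'.filter fun e => ∃ j, a e = X j := by
      intro h
      refine hσ fun i => ?_
      have hi : (i, σ i) ∈ E'.filter fun e => ∃ j, a e = X j := h i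
      rw [Finset.mem_filter] at hi
      exact hi.1
    rw [if_neg hσ, map_zero, if_neg hnot]

/-- A label polynomial is a projection: `Σ_{σ ⊆ H} Π_i X (φ (i, σ i)) = PM_H (X ∘ φ)`.
[folklore] -/
theorem labelPoly_eq_aeval (H : Finset (Fin n × Fin n)) (φ : Fin n × Fin n → Fin n × Fin n) :
    (∑ σ : Equiv.Perm (Fin n), if (∀ i, (i, σ i) ∈ H) then
        ∏ i, (X (φ (i, σ i)) : MvPolynomial (Fin n × Fin n) ℂ) else 0) =
      aeval (fun e => (X (φ e) : MvPolynomial (Fin n × Fin n) ℂ)) (perfectMatchingPoly H ℂ) := by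
  rw [aeval_perfectMatchingPoly_eq_sum]

/-- **Reduction.** The combinatorial label-transfer principle implies `SignedCoverLittle`:
substitute the projection, kill the constants by degree (`PM_E` is homogeneous of degree `n`),
and apply the principle to the Pfaffian subgraph `H ⊆ E'` of variable cells. [folklore] -/
theorem signedCoverLittle_of_labelTransfer
    (hT : ∀ (n : ℕ) (H E : Finset (Fin n × Fin n)) (φ : Fin n × Fin n → Fin n × Fin n),
      IsPfaffianBipartite H →
      (∑ σ : Equiv.Perm (Fin n), if (∀ i, (i, σ i) ∈ H) then
          ∏ i, (X (φ (i, σ i)) : MvPolynomial (Fin n × Fin n) ℂ) else 0) =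
        perfectMatchingPoly E ℂ →
      IsPfaffianBipartite E) :
    Summit.ValiantsHypothesis.ValiantsHypothesis.Theses.PolyaContinued.SignedCoverLittle := by
  unfold Summit.ValiantsHypothesis.ValiantsHypothesis.Theses.PolyaContinued.SignedCoverLittle
  intro n E E' P P' hP hP' _hP0 hPf hproj
  classical
  have h2 : (2 : ℂ) ≠ 0 := two_ne_zero
  -- the route's inlined objects are the tree's `perfectMatchingPoly` / `IsPfaffianBipartite`
  have hP1 : P = perfectMatchingPoly E ℂ := hP
  have hP'1 : P' = perfectMatchingPoly E' ℂ := hP'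
  have hE' : IsPfaffianBipartite E' := by
    rw [hP'] at hPf
    exact (isPfaffianBipartite_iff_exists_mvPolynomial E' h2).2 hPf
  rw [hP, ← isPfaffianBipartite_iff_exists_mvPolynomial E h2]
  -- the projection
  obtain ⟨a, ha, hPa⟩ := hproj
  let φ : Fin n × Fin n → Fin n × Fin n := fun e => if h : ∃ j, a e = X j then h.choose else e
  have hφ : ∀ e j, a e = X j → a e = X (φ e) := by
    intro e j hj
    have h : ∃ j, a e = X j := ⟨j, hj⟩
    show a e = X (if h : ∃ j, a e = X j then h.choose else e)
    rw [dif_pos h]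
    exact h.choose_spec
  let H : Finset (Fin n × Fin n) := E'.filter fun e => ∃ j, a e = X j
  refine hT n H E φ (hE'.anti (Finset.filter_subset _ _)) ?_
  -- kill the constants by degree
  have hhom : (perfectMatchingPoly E ℂ).IsHomogeneous n := by
    simpa using perfectMatchingPoly_isHomogeneous E ℂ
  calc (∑ σ : Equiv.Perm (Fin n), if (∀ i, (i, σ i) ∈ H) then
          ∏ i, (X (φ (i, σ i)) : MvPolynomial (Fin n × Fin n) ℂ) else 0)
      = homogeneousComponent n (aeval a (perfectMatchingPoly E' ℂ)) :=
        (homogeneousComponent_aeval_perfectMatchingPoly E' a ha φ hφ).symm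
    _ = homogeneousComponent n (perfectMatchingPoly E ℂ) := by rw [← hP'1, ← hPa, hP1]
    _ = perfectMatchingPoly E ℂ := homogeneousComponent_eq_self hhom

/-- **Converse.** `SignedCoverLittle` implies the label-transfer principle: a label polynomial
identity `Σ_{σ ⊆ H} Π_i X (φ (i, σ i)) = PM_E` is the projection `x_e ↦ x_{φ e}` of `PM_H`
(no constants), and a Pfaffian `H` supplies the signed cover. [folklore] -/
theorem labelTransfer_of_signedCoverLittle
    (h : Summit.ValiantsHypothesis.ValiantsHypothesis.Theses.PolyaContinued.SignedCoverLittle)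
    (n : ℕ) (H E : Finset (Fin n × Fin n)) (φ : Fin n × Fin n → Fin n × Fin n)
    (hH : IsPfaffianBipartite H)
    (hid : (∑ σ : Equiv.Perm (Fin n), if (∀ i, (i, σ i) ∈ H) then
        ∏ i, (X (φ (i, σ i)) : MvPolynomial (Fin n × Fin n) ℂ) else 0) =
      perfectMatchingPoly E ℂ) :
    IsPfaffianBipartite E := by
  have h2 : (2 : ℂ) ≠ 0 := two_ne_zero
  by_cases hE : perfectMatchingPoly E ℂ = 0
  · -- no perfect matching: vacuously Pfaffian
    refine isPfaffianBipartite_of_forall_exists_not_mem fun σ => ?_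
    by_contra hσ
    push Not at hσ
    exact (perfectMatchingPoly_ne_zero_iff (G := E) (R := ℂ)).2 ⟨σ, hσ⟩ hE
  · obtain ⟨s', hs'1, hdet⟩ := (isPfaffianBipartite_iff_exists_mvPolynomial H h2).1 hH
    rw [isPfaffianBipartite_iff_exists_mvPolynomial E h2]
    unfold Summit.ValiantsHypothesis.ValiantsHypothesis.Theses.PolyaContinued.SignedCoverLittle at h
    refine h n E H (perfectMatchingPoly E ℂ) (perfectMatchingPoly H ℂ) rfl rfl hE ⟨s', hs'1, hdet⟩
      ⟨fun e => X (φ e), fun e => Or.inl ⟨φ e, rfl⟩, ?_⟩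
    rw [← labelPoly_eq_aeval, hid]

/-- **`SignedCoverLittle` is equivalent to the label-transfer principle**: `E` inherits
Pfaffian-ness from a Pfaffian `H ⊆ K_{n,n}` whose perfect matchings, read through an arbitrary
cell relabelling `φ`, are exactly the perfect matchings of `E` (as the polynomial identity
`Σ_{σ ⊆ H} Π_i X (φ (i, σ i)) = PM_E`). The item is thereby a statement about bipartite graphs and
relabellings only; constants and signs play no role. [folklore] -/
theorem signedCoverLittle_iff_labelTransfer :
    Summit.ValiantsHypothesis.ValiantsHypothesis.Theses.PolyaContinued.SignedCoverLittle ↔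
      ∀ (n : ℕ) (H E : Finset (Fin n × Fin n)) (φ : Fin n × Fin n → Fin n × Fin n),
        IsPfaffianBipartite H →
        (∑ σ : Equiv.Perm (Fin n), if (∀ i, (i, σ i) ∈ H) then
            ∏ i, (X (φ (i, σ i)) : MvPolynomial (Fin n × Fin n) ℂ) else 0) =
          perfectMatchingPoly E ℂ →
        IsPfaffianBipartite E :=
  ⟨labelTransfer_of_signedCoverLittle, signedCoverLittle_of_labelTransfer⟩

end Summit.ValiantsHypothesis.PolyaContinued
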